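import Mathlib
import Summits.Ventures.PercRepro2.SixTypedCore
import Summits.Ventures.PercRepro2.SortedPairs6
import Summits.Ventures.PercRepro2.MonoTPos
import Summits.Ventures.PercRepro2.TypedResidualDegree
import Summits.Ventures.PercRepro2.TypedResidualCruxMarks

/-!
# Six typed edges, XI: the reduced class (blind cell PercRepro2, night-3, 2026-08-25)

From the hypotheses of the reduced class to the label-level guards of the sorted core, in the
all-closed configuration (`labc_eq_iff`: labels agree iff the points coincide):

* `labc_marks`: the marks `a₁ … a₃` carry the labels `0, 1, 2, {3 | 2}, {4 | 3}` — five distinct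
  marks, `b = a₃`, or `o = b` (`MarksDistinct`);
* `labc_loop` / `labc_par` / `labc_root`: no loop, no parallel pair, no root pair (`Reduced`);
* `edeg6_eq`: the edge-degree of a label is the typed degree of its vertex, hence `labc_deg`:
  the leaf guard `degOK6` (`Reduced.typedDeg_unmarked`, `typedDeg_o`, `typedDeg_b`);
* **`typedCount_sext_K3_nonneg`** and **`typedCount_nonneg_of_reduced_card_six`**: row 2′TRI on
  every reduced instance with six typed edges (`z ≡ false`, marks distinct up to `b = a₃` / `o = b`),
  modulo `allOk6 = true` — the sorted member of the orbit (`exists_sorted6`) and the sorted core.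
-/

namespace Summit.Ventures.PercRepro2

open UnionCluster

namespace CovForm

namespace TwoTyped

open OneTyped TypedRed

section Bridge6

open Classical TypedRed

variable {V : Type*} {E : Type*} [DecidableEq V] [Fintype E] [DecidableEq E] {R : Type*} [Field R]
  [LinearOrder R] [IsStrictOrderedRing R]
variable (ends : E → Sym2 V) (o a₁ a₂ a₃ b : V) (ps : Fin 6 → V × V)

omit [DecidableEq V] [Fintype E] [DecidableEq E] in
/-- In the all-closed configuration, labels agree exactly when the points coincide. -/
lemma labc_eq_iff (p q : ℕ) :
    labc ends o a₁ a₂ a₃ b ps p = labc ends o a₁ a₂ a₃ b ps q ↔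
      pt o a₁ a₂ a₃ b (xsOf6 ps) p = pt o a₁ a₂ a₃ b (xsOf6 ps) q := by
  unfold labc
  rw [lab_eq_iff, conn_allClosed_iff]

omit [DecidableEq V] [Fintype E] [DecidableEq E] in
/-- `a₁` carries the label `0`. -/
lemma labc_zero : labc ends o a₁ a₂ a₃ b ps 0 = 0 := lab_zero ends o a₁ a₂ a₃ b (xsOf6 ps) _

omit [DecidableEq V] [Fintype E] [DecidableEq E] in
/-- A label is at most its index. -/
lemma labc_le (i : ℕ) : labc ends o a₁ a₂ a₃ b ps i ≤ i := lab_le ends o a₁ a₂ a₃ b (xsOf6 ps) _ i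

omit [DecidableEq V] [Fintype E] [DecidableEq E] in
/-- Labels are idempotent. -/
lemma labc_idem (i : ℕ) :
    labc ends o a₁ a₂ a₃ b ps (labc ends o a₁ a₂ a₃ b ps i) = labc ends o a₁ a₂ a₃ b ps i :=
  lab_idem ends o a₁ a₂ a₃ b (xsOf6 ps) _ i

omit [DecidableEq V] [Fintype E] [DecidableEq E] in
/-- **The labels of the marks**: `a₂ ↦ 1`, `o ↦ 2`, `b ↦ 3` or `2` (`o = b`), `a₃ ↦ 4` or `3`
(`a₃ = b`). -/
lemma labc_marks (hm : MarksDistinct o a₁ a₂ a₃ b) :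
    labc ends o a₁ a₂ a₃ b ps 1 = 1 ∧ labc ends o a₁ a₂ a₃ b ps 2 = 2 ∧
      ((labc ends o a₁ a₂ a₃ b ps 3 = 3 ∧ labc ends o a₁ a₂ a₃ b ps 4 = 4) ∨
        (labc ends o a₁ a₂ a₃ b ps 3 = 3 ∧ labc ends o a₁ a₂ a₃ b ps 4 = 3) ∨
        (labc ends o a₁ a₂ a₃ b ps 3 = 2 ∧ labc ends o a₁ a₂ a₃ b ps 4 = 4)) := by
  obtain ⟨⟨h12, h31, h32, ho1, ho2, hb1, hb2⟩, ho3⟩ := hm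
  have e := labc_eq_iff ends o a₁ a₂ a₃ b ps
  have z := labc_zero ends o a₁ a₂ a₃ b ps
  have l1 := labc_le ends o a₁ a₂ a₃ b ps 1
  have l2 := labc_le ends o a₁ a₂ a₃ b ps 2
  have l3 := labc_le ends o a₁ a₂ a₃ b ps 3
  have l4 := labc_le ends o a₁ a₂ a₃ b ps 4
  have i4 := labc_idem ends o a₁ a₂ a₃ b ps 4
  have p0 : pt o a₁ a₂ a₃ b (xsOf6 ps) 0 = a₁ := rfl
  have p1 : pt o a₁ a₂ a₃ b (xsOf6 ps) 1 = a₂ := rfl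
  have p2 : pt o a₁ a₂ a₃ b (xsOf6 ps) 2 = o := rfl
  have p3 : pt o a₁ a₂ a₃ b (xsOf6 ps) 3 = b := rfl
  have p4 : pt o a₁ a₂ a₃ b (xsOf6 ps) 4 = a₃ := rfl
  have f1 : labc ends o a₁ a₂ a₃ b ps 1 = 1 := by
    by_contra h
    have h0 : labc ends o a₁ a₂ a₃ b ps 1 = labc ends o a₁ a₂ a₃ b ps 0 := by omega
    rw [e, p1, p0] at h0
    exact h12 h0.symm
  have f2 : labc ends o a₁ a₂ a₃ b ps 2 = 2 := by
    by_contra h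
    rcases (show labc ends o a₁ a₂ a₃ b ps 2 = 0 ∨ labc ends o a₁ a₂ a₃ b ps 2 = 1 by omega) with h0 | h0
    · have := (e 2 0).mp (by rw [h0, z]); rw [p2, p0] at this; exact ho1 this
    · have := (e 2 1).mp (by rw [h0, f1]); rw [p2, p1] at this; exact ho2 this
  have f3 : labc ends o a₁ a₂ a₃ b ps 3 = 3 ∨ labc ends o a₁ a₂ a₃ b ps 3 = 2 := by
    by_contra h
    rcases (show labc ends o a₁ a₂ a₃ b ps 3 = 0 ∨ labc ends o a₁ a₂ a₃ b ps 3 = 1 by omega) with h0 | h0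
    · have := (e 3 0).mp (by rw [h0, z]); rw [p3, p0] at this; exact hb1 this
    · have := (e 3 1).mp (by rw [h0, f1]); rw [p3, p1] at this; exact hb2 this
  have f4 : labc ends o a₁ a₂ a₃ b ps 4 = 4 ∨ labc ends o a₁ a₂ a₃ b ps 4 = 3 := by
    by_contra h
    rcases (show labc ends o a₁ a₂ a₃ b ps 4 = 0 ∨ labc ends o a₁ a₂ a₃ b ps 4 = 1 ∨
        labc ends o a₁ a₂ a₃ b ps 4 = 2 by omega) with h0 | h0 | h0
    · have := (e 4 0).mp (by rw [h0, z]); rw [p4, p0] at this; exact h31 this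
    · have := (e 4 1).mp (by rw [h0, f1]); rw [p4, p1] at this; exact h32 this
    · have := (e 4 2).mp (by rw [h0, f2]); rw [p4, p2] at this; exact ho3 this.symm
  refine ⟨f1, f2, ?_⟩
  rcases f3 with h3 | h3 <;> rcases f4 with h4 | h4
  · exact Or.inl ⟨h3, h4⟩
  · exact Or.inr (Or.inl ⟨h3, h4⟩)
  · exact Or.inr (Or.inr ⟨h3, h4⟩)
  · exfalso
    rw [h4, h3] at i4
    omega

omit [DecidableEq V] [Fintype E] [DecidableEq E] in
/-- No typed loop: the two ends of a typed edge carry different labels. -/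
lemma labc_loop {F : Finset E} (hred : Reduced ends o a₁ a₂ a₃ b F) {e : E} (he : e ∈ F)
    {x y : V} (hends : ends e = s(x, y)) {u w : ℕ} (hu : pt o a₁ a₂ a₃ b (xsOf6 ps) u = x)
    (hw : pt o a₁ a₂ a₃ b (xsOf6 ps) w = y) :
    labc ends o a₁ a₂ a₃ b ps u ≠ labc ends o a₁ a₂ a₃ b ps w := by
  intro h
  rw [labc_eq_iff, hu, hw] at h
  exact hred.no_loop e he (by rw [hends, h]; exact Sym2.mk_isDiag_iff.mpr rfl)

omit [DecidableEq V] [Fintype E] [DecidableEq E] in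
/-- No parallel typed pair: two typed edges do not carry the same ordered label pair. -/
lemma labc_par {F : Finset E} (hred : Reduced ends o a₁ a₂ a₃ b F) {e e' : E} (he : e ∈ F)
    (he' : e' ∈ F) (hne : e ≠ e') {x y x' y' : V} (hends : ends e = s(x, y))
    (hends' : ends e' = s(x', y')) {u w u' w' : ℕ} (hu : pt o a₁ a₂ a₃ b (xsOf6 ps) u = x)
    (hw : pt o a₁ a₂ a₃ b (xsOf6 ps) w = y) (hu' : pt o a₁ a₂ a₃ b (xsOf6 ps) u' = x')
    (hw' : pt o a₁ a₂ a₃ b (xsOf6 ps) w' = y') :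
    labc ends o a₁ a₂ a₃ b ps u = labc ends o a₁ a₂ a₃ b ps u' →
      labc ends o a₁ a₂ a₃ b ps w ≠ labc ends o a₁ a₂ a₃ b ps w' := by
  intro h1 h2
  rw [labc_eq_iff, hu, hu'] at h1
  rw [labc_eq_iff, hw, hw'] at h2
  exact hred.no_parallel e he e' he' hne (by rw [hends, hends', h1, h2])

omit [DecidableEq V] [Fintype E] [DecidableEq E] in
/-- No typed root pair: no typed edge carries the labels `(0, 1)`. -/
lemma labc_root (hm : MarksDistinct o a₁ a₂ a₃ b) {F : Finset E} (hred : Reduced ends o a₁ a₂ a₃ b F)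
    {e : E} (he : e ∈ F) {x y : V} (hends : ends e = s(x, y)) {u w : ℕ}
    (hu : pt o a₁ a₂ a₃ b (xsOf6 ps) u = x) (hw : pt o a₁ a₂ a₃ b (xsOf6 ps) w = y) :
    ¬ (labc ends o a₁ a₂ a₃ b ps u = 0 ∧ labc ends o a₁ a₂ a₃ b ps w = 1) := by
  rintro ⟨h0, h1⟩
  have e0 : labc ends o a₁ a₂ a₃ b ps u = labc ends o a₁ a₂ a₃ b ps 0 := by
    rw [h0, labc_zero]
  have e1 : labc ends o a₁ a₂ a₃ b ps w = labc ends o a₁ a₂ a₃ b ps 1 := by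
    rw [h1, (labc_marks ends o a₁ a₂ a₃ b ps hm).1]
  rw [labc_eq_iff, hu] at e0
  rw [labc_eq_iff, hw] at e1
  exact hred.no_root_pair e he (by rw [hends, e0, e1]; rfl)

omit [Fintype E] in
/-- The typed degree over six distinct typed edges, as six indicators. -/
lemma typedDeg_six (e1 e2 e3 e4 e5 e6 : E) (h12 : e1 ≠ e2) (h13 : e1 ≠ e3) (h14 : e1 ≠ e4)
    (h15 : e1 ≠ e5) (h16 : e1 ≠ e6) (h23 : e2 ≠ e3) (h24 : e2 ≠ e4) (h25 : e2 ≠ e5) (h26 : e2 ≠ e6)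
    (h34 : e3 ≠ e4) (h35 : e3 ≠ e5) (h36 : e3 ≠ e6) (h45 : e4 ≠ e5) (h46 : e4 ≠ e6) (h56 : e5 ≠ e6)
    (v : V) :
    typedDeg ends {e1, e2, e3, e4, e5, e6} v =
      (if v ∈ ends e1 then 1 else 0) + (if v ∈ ends e2 then 1 else 0) + (if v ∈ ends e3 then 1 else 0) +
        (if v ∈ ends e4 then 1 else 0) + (if v ∈ ends e5 then 1 else 0) + (if v ∈ ends e6 then 1 else 0) := by
  unfold typedDeg
  rw [Finset.card_filter, Finset.sum_insert (by simp [h12, h13, h14, h15, h16]),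
    Finset.sum_insert (by simp [h23, h24, h25, h26]), Finset.sum_insert (by simp [h34, h35, h36]),
    Finset.sum_insert (by simp [h45, h46]), Finset.sum_insert (by simp [h56]), Finset.sum_singleton]
  ring

omit [Fintype E] in
/-- **The edge-degree of a label is the typed degree of its vertex.** -/
lemma edeg6_eq (e1 e2 e3 e4 e5 e6 : E) (h12 : e1 ≠ e2) (h13 : e1 ≠ e3) (h14 : e1 ≠ e4)
    (h15 : e1 ≠ e5) (h16 : e1 ≠ e6) (h23 : e2 ≠ e3) (h24 : e2 ≠ e4) (h25 : e2 ≠ e5) (h26 : e2 ≠ e6)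
    (h34 : e3 ≠ e4) (h35 : e3 ≠ e5) (h36 : e3 ≠ e6) (h45 : e4 ≠ e5) (h46 : e4 ≠ e6) (h56 : e5 ≠ e6)
    (hends1 : ends e1 = s((ps 0).1, (ps 0).2)) (hends2 : ends e2 = s((ps 1).1, (ps 1).2))
    (hends3 : ends e3 = s((ps 2).1, (ps 2).2)) (hends4 : ends e4 = s((ps 3).1, (ps 3).2))
    (hends5 : ends e5 = s((ps 4).1, (ps 4).2)) (hends6 : ends e6 = s((ps 5).1, (ps 5).2)) (p : ℕ) :
    edeg6 (labc ends o a₁ a₂ a₃ b ps p) (labc ends o a₁ a₂ a₃ b ps 5) (labc ends o a₁ a₂ a₃ b ps 6)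
      (labc ends o a₁ a₂ a₃ b ps 7) (labc ends o a₁ a₂ a₃ b ps 8) (labc ends o a₁ a₂ a₃ b ps 9)
      (labc ends o a₁ a₂ a₃ b ps 10) (labc ends o a₁ a₂ a₃ b ps 11) (labc ends o a₁ a₂ a₃ b ps 12)
      (labc ends o a₁ a₂ a₃ b ps 13) (labc ends o a₁ a₂ a₃ b ps 14) (labc ends o a₁ a₂ a₃ b ps 15)
      (labc ends o a₁ a₂ a₃ b ps 16) =
      typedDeg ends {e1, e2, e3, e4, e5, e6} (pt o a₁ a₂ a₃ b (xsOf6 ps) p) := by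
  rw [typedDeg_six ends e1 e2 e3 e4 e5 e6 h12 h13 h14 h15 h16 h23 h24 h25 h26 h34 h35 h36 h45 h46 h56]
  unfold edeg6
  simp only [hends1, hends2, hends3, hends4, hends5, hends6, Sym2.mem_iff, ← pt_xsOf6_5 o a₁ a₂ a₃ b ps, ← pt_xsOf6_6 o a₁ a₂ a₃ b ps, ← pt_xsOf6_7 o a₁ a₂ a₃ b ps, ← pt_xsOf6_8 o a₁ a₂ a₃ b ps, ← pt_xsOf6_9 o a₁ a₂ a₃ b ps, ← pt_xsOf6_10 o a₁ a₂ a₃ b ps, ← pt_xsOf6_11 o a₁ a₂ a₃ b ps, ← pt_xsOf6_12 o a₁ a₂ a₃ b ps, ← pt_xsOf6_13 o a₁ a₂ a₃ b ps, ← pt_xsOf6_14 o a₁ a₂ a₃ b ps, ← pt_xsOf6_15 o a₁ a₂ a₃ b ps, ← pt_xsOf6_16 o a₁ a₂ a₃ b ps,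
    ← labc_eq_iff ends o a₁ a₂ a₃ b ps]
  simp only [eq_comm]

omit [Fintype E] [DecidableEq E] in
/-- A nonzero typed degree gives a typed edge at the vertex. -/
lemma exists_edge_of_typedDeg_ne_zero {F : Finset E} {v : V} (h : typedDeg ends F v ≠ 0) :
    ∃ f ∈ F, v ∈ ends f := by
  unfold typedDeg at h
  obtain ⟨f, hf⟩ := Finset.card_ne_zero.mp h
  rw [Finset.mem_filter] at hf
  exact ⟨f, hf.1, hf.2⟩

omit [Fintype E] in
/-- **The leaf guard holds on a reduced instance**: unmarked labels have typed degree `≥ 3`; `o`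
(when `o ≠ b`) and `b` (when distinct from `o`, `a₃`) are not typed leaves. -/
lemma labc_deg (hm : MarksDistinct o a₁ a₂ a₃ b) (e1 e2 e3 e4 e5 e6 : E)
    (hred : Reduced ends o a₁ a₂ a₃ b {e1, e2, e3, e4, e5, e6})
    (h12 : e1 ≠ e2) (h13 : e1 ≠ e3) (h14 : e1 ≠ e4)
    (h15 : e1 ≠ e5) (h16 : e1 ≠ e6) (h23 : e2 ≠ e3) (h24 : e2 ≠ e4) (h25 : e2 ≠ e5) (h26 : e2 ≠ e6)
    (h34 : e3 ≠ e4) (h35 : e3 ≠ e5) (h36 : e3 ≠ e6) (h45 : e4 ≠ e5) (h46 : e4 ≠ e6) (h56 : e5 ≠ e6)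
    (hends1 : ends e1 = s((ps 0).1, (ps 0).2)) (hends2 : ends e2 = s((ps 1).1, (ps 1).2))
    (hends3 : ends e3 = s((ps 2).1, (ps 2).2)) (hends4 : ends e4 = s((ps 3).1, (ps 3).2))
    (hends5 : ends e5 = s((ps 4).1, (ps 4).2)) (hends6 : ends e6 = s((ps 5).1, (ps 5).2)) :
    degOK6 (labc ends o a₁ a₂ a₃ b ps 3) (labc ends o a₁ a₂ a₃ b ps 4) (labc ends o a₁ a₂ a₃ b ps 5)
      (labc ends o a₁ a₂ a₃ b ps 6) (labc ends o a₁ a₂ a₃ b ps 7) (labc ends o a₁ a₂ a₃ b ps 8)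
      (labc ends o a₁ a₂ a₃ b ps 9) (labc ends o a₁ a₂ a₃ b ps 10) (labc ends o a₁ a₂ a₃ b ps 11)
      (labc ends o a₁ a₂ a₃ b ps 12) (labc ends o a₁ a₂ a₃ b ps 13) (labc ends o a₁ a₂ a₃ b ps 14)
      (labc ends o a₁ a₂ a₃ b ps 15) (labc ends o a₁ a₂ a₃ b ps 16) = true := by
  have hdeg := edeg6_eq ends o a₁ a₂ a₃ b ps e1 e2 e3 e4 e5 e6 h12 h13 h14 h15 h16 h23 h24 h25 h26 h34 h35
    h36 h45 h46 h56 hends1 hends2 hends3 hends4 hends5 hends6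
  have hmk := labc_marks ends o a₁ a₂ a₃ b ps hm
  have hle := labc_le ends o a₁ a₂ a₃ b ps
  have heq := labc_eq_iff ends o a₁ a₂ a₃ b ps
  obtain ⟨⟨h12', h31, h32, ho1, ho2, hb1, hb2⟩, ho3⟩ := hm
  -- the edge containing an end position
  have hmem : ∀ p, 5 ≤ p → p ≤ 16 → ∃ f ∈ ({e1, e2, e3, e4, e5, e6} : Finset E),
      pt o a₁ a₂ a₃ b (xsOf6 ps) p ∈ ends f := by
    intro p hp5 hp16
    interval_cases p
    · exact ⟨e1, by simp, by rw [hends1]; exact Sym2.mem_mk_left _ _⟩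
    · exact ⟨e1, by simp, by rw [hends1]; exact Sym2.mem_mk_right _ _⟩
    · exact ⟨e2, by simp, by rw [hends2]; exact Sym2.mem_mk_left _ _⟩
    · exact ⟨e2, by simp, by rw [hends2]; exact Sym2.mem_mk_right _ _⟩
    · exact ⟨e3, by simp, by rw [hends3]; exact Sym2.mem_mk_left _ _⟩
    · exact ⟨e3, by simp, by rw [hends3]; exact Sym2.mem_mk_right _ _⟩
    · exact ⟨e4, by simp, by rw [hends4]; exact Sym2.mem_mk_left _ _⟩
    · exact ⟨e4, by simp, by rw [hends4]; exact Sym2.mem_mk_right _ _⟩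
    · exact ⟨e5, by simp, by rw [hends5]; exact Sym2.mem_mk_left _ _⟩
    · exact ⟨e5, by simp, by rw [hends5]; exact Sym2.mem_mk_right _ _⟩
    · exact ⟨e6, by simp, by rw [hends6]; exact Sym2.mem_mk_left _ _⟩
    · exact ⟨e6, by simp, by rw [hends6]; exact Sym2.mem_mk_right _ _⟩
  -- an end with a label `≥ 5` is an unmarked vertex of typed degree `≥ 3`
  have hunm : ∀ p, 5 ≤ p → p ≤ 16 → labc ends o a₁ a₂ a₃ b ps p < 5 ∨
      3 ≤ edeg6 (labc ends o a₁ a₂ a₃ b ps p) (labc ends o a₁ a₂ a₃ b ps 5) (labc ends o a₁ a₂ a₃ b ps 6)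
        (labc ends o a₁ a₂ a₃ b ps 7) (labc ends o a₁ a₂ a₃ b ps 8) (labc ends o a₁ a₂ a₃ b ps 9)
        (labc ends o a₁ a₂ a₃ b ps 10) (labc ends o a₁ a₂ a₃ b ps 11) (labc ends o a₁ a₂ a₃ b ps 12)
        (labc ends o a₁ a₂ a₃ b ps 13) (labc ends o a₁ a₂ a₃ b ps 14) (labc ends o a₁ a₂ a₃ b ps 15)
        (labc ends o a₁ a₂ a₃ b ps 16) := by
    intro p hp5 hp16
    by_cases hlt : labc ends o a₁ a₂ a₃ b ps p < 5
    · exact Or.inl hlt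
    right
    rw [hdeg p]
    obtain ⟨f, hf, hpf⟩ := hmem p hp5 hp16
    have hne : ∀ q, q < 5 → pt o a₁ a₂ a₃ b (xsOf6 ps) p ≠ pt o a₁ a₂ a₃ b (xsOf6 ps) q := by
      intro q hq h
      have := (heq p q).mpr h
      have := hle q
      omega
    exact hred.typedDeg_unmarked (hne 2 (by omega)) (hne 0 (by omega)) (hne 1 (by omega))
      (hne 4 (by omega)) (hne 3 (by omega)) hf hpf
  have ho : labc ends o a₁ a₂ a₃ b ps 3 = 2 ∨
      edeg6 2 (labc ends o a₁ a₂ a₃ b ps 5) (labc ends o a₁ a₂ a₃ b ps 6)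
        (labc ends o a₁ a₂ a₃ b ps 7) (labc ends o a₁ a₂ a₃ b ps 8) (labc ends o a₁ a₂ a₃ b ps 9)
        (labc ends o a₁ a₂ a₃ b ps 10) (labc ends o a₁ a₂ a₃ b ps 11) (labc ends o a₁ a₂ a₃ b ps 12)
        (labc ends o a₁ a₂ a₃ b ps 13) (labc ends o a₁ a₂ a₃ b ps 14) (labc ends o a₁ a₂ a₃ b ps 15)
        (labc ends o a₁ a₂ a₃ b ps 16) ≠ 1 := by
    by_cases h3 : labc ends o a₁ a₂ a₃ b ps 3 = 2
    · exact Or.inl h3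
    right
    have hob : o ≠ b := by
      intro h
      apply h3
      rw [← hmk.2.1]
      exact (heq 3 2).mpr h.symm
    rw [← hmk.2.1, hdeg 2]
    have p2 : pt o a₁ a₂ a₃ b (xsOf6 ps) 2 = o := rfl
    rw [p2]
    intro h1
    obtain ⟨f, hf, hof⟩ := exists_edge_of_typedDeg_ne_zero ends (by rw [h1]; exact one_ne_zero)
    have := hred.typedDeg_o ho1 ho2 ho3 hob hf hof
    omega
  have hb : (labc ends o a₁ a₂ a₃ b ps 3 ≠ 3 ∨ labc ends o a₁ a₂ a₃ b ps 4 ≠ 4) ∨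
      edeg6 3 (labc ends o a₁ a₂ a₃ b ps 5) (labc ends o a₁ a₂ a₃ b ps 6)
        (labc ends o a₁ a₂ a₃ b ps 7) (labc ends o a₁ a₂ a₃ b ps 8) (labc ends o a₁ a₂ a₃ b ps 9)
        (labc ends o a₁ a₂ a₃ b ps 10) (labc ends o a₁ a₂ a₃ b ps 11) (labc ends o a₁ a₂ a₃ b ps 12)
        (labc ends o a₁ a₂ a₃ b ps 13) (labc ends o a₁ a₂ a₃ b ps 14) (labc ends o a₁ a₂ a₃ b ps 15)
        (labc ends o a₁ a₂ a₃ b ps 16) ≠ 1 := by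
    by_cases h34 : labc ends o a₁ a₂ a₃ b ps 3 = 3 ∧ labc ends o a₁ a₂ a₃ b ps 4 = 4
    swap
    · left
      by_contra hc
      exact h34 ⟨not_not.mp (not_or.mp hc).1, not_not.mp (not_or.mp hc).2⟩
    right
    have hbo : b ≠ o := by
      intro h
      have := (heq 3 2).mpr h
      omega
    have hb3 : b ≠ a₃ := by
      intro h
      have := (heq 3 4).mpr h
      omega
    rw [← h34.1, hdeg 3]
    have p3 : pt o a₁ a₂ a₃ b (xsOf6 ps) 3 = b := rfl
    rw [p3]
    intro h1
    obtain ⟨f, hf, hbf⟩ := exists_edge_of_typedDeg_ne_zero ends (by rw [h1]; exact one_ne_zero)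
    have := hred.typedDeg_b hbo hb1 hb2 hb3 hf hbf
    omega
  unfold degOK6
  simp only [Bool.and_eq_true, decide_eq_true_eq]
  exact ⟨⟨⟨hunm 5 (by omega) (by omega), hunm 6 (by omega) (by omega), hunm 7 (by omega) (by omega),
    hunm 8 (by omega) (by omega), hunm 9 (by omega) (by omega), hunm 10 (by omega) (by omega),
    hunm 11 (by omega) (by omega), hunm 12 (by omega) (by omega), hunm 13 (by omega) (by omega),
    hunm 14 (by omega) (by omega), hunm 15 (by omega) (by omega), hunm 16 (by omega) (by omega)⟩, ho⟩, hb⟩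

/-- **Six typed edges of a reduced instance**, modulo `allOk6 = true`: for six distinct typed edges
forming a reduced typed graph (marks distinct up to `b = a₃` / `o = b`), the typed count of `K₃` in
the all-closed configuration is nonnegative — the ends are re-ordered and re-oriented to the
sorted member of their orbit (`exists_sorted6`) and the sorted core applies. -/
theorem typedCount_sext_K3_nonneg (hall : allOk6 = true) (hm : MarksDistinct o a₁ a₂ a₃ b)
    (e : Fin 6 → E) (hinj : Function.Injective e)
    (hred : Reduced ends o a₁ a₂ a₃ b (Finset.univ.image e)) (τ : E → ℕ)
    (hτ : ∀ i, τ (e i) = 1 ∨ τ (e i) = 2) :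
    0 ≤ typedCount (Finset.univ.image e) (fun _ => false) τ
      (K3 ends o a₁ a₂ a₃ b : Config E → Config E → Config E → R) := by
  have hex : ∀ i : Fin 6, ∃ p : V × V, ends (e i) = s(p.1, p.2) := fun i => by
    obtain ⟨⟨u, w⟩, h⟩ := Quot.exists_rep (ends (e i))
    exact ⟨(u, w), h.symm⟩
  choose ps hps using hex
  obtain ⟨σ, fl, hsort⟩ := exists_sorted6 ends o a₁ a₂ a₃ b (fun _ => false) ps
  have hF : Finset.univ.image e = ({e (σ 0), e (σ 1), e (σ 2), e (σ 3), e (σ 4), e (σ 5)} : Finset E) := by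
    rw [← Finset.image_univ_of_surjective σ.surjective, Finset.image_image]
    ext x
    simp only [Finset.mem_image, Finset.mem_univ, true_and, Finset.mem_insert, Finset.mem_singleton,
      Function.comp]
    constructor
    · rintro ⟨i, rfl⟩
      fin_cases i <;> simp
    · rintro (rfl | rfl | rfl | rfl | rfl | rfl) <;> exact ⟨_, rfl⟩
  have hends' : ∀ i, ends (e (σ i)) = s((act6 σ fl ps i).1, (act6 σ fl ps i).2) := by
    intro i
    simp only [act6]
    split_ifs
    · rw [hps (σ i), Sym2.eq_swap]
    · exact hps (σ i)
  have hne : ∀ i j : Fin 6, i ≠ j → e (σ i) ≠ e (σ j) := fun i j hij h =>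
    hij (σ.injective (hinj h))
  rw [hF] at hred ⊢
  have hmem : ∀ i : Fin 6, e (σ i) ∈ ({e (σ 0), e (σ 1), e (σ 2), e (σ 3), e (σ 4), e (σ 5)} : Finset E) := by
    intro i
    fin_cases i <;> simp
  have hred' := hred
  refine typedCount_sext_core ends o a₁ a₂ a₃ b hall (e (σ 0)) (e (σ 1)) (e (σ 2)) (e (σ 3)) (e (σ 4)) (e (σ 5))
    (hne 0 1 (by decide)) (hne 0 2 (by decide)) (hne 0 3 (by decide)) (hne 0 4 (by decide)) (hne 0 5 (by decide)) (hne 1 2 (by decide)) (hne 1 3 (by decide)) (hne 1 4 (by decide)) (hne 1 5 (by decide)) (hne 2 3 (by decide)) (hne 2 4 (by decide)) (hne 2 5 (by decide)) (hne 3 4 (by decide)) (hne 3 5 (by decide)) (hne 4 5 (by decide)) τ ?_ (act6 σ fl ps)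
    (hends' 0) (hends' 1) (hends' 2) (hends' 3) (hends' 4) (hends' 5) hsort
    (labc_marks ends o a₁ a₂ a₃ b (act6 σ fl ps) hm)
    (labc_loop ends o a₁ a₂ a₃ b (act6 σ fl ps) hred' (hmem 0) (hends' 0) rfl rfl) (labc_loop ends o a₁ a₂ a₃ b (act6 σ fl ps) hred' (hmem 1) (hends' 1) rfl rfl) (labc_loop ends o a₁ a₂ a₃ b (act6 σ fl ps) hred' (hmem 2) (hends' 2) rfl rfl) (labc_loop ends o a₁ a₂ a₃ b (act6 σ fl ps) hred' (hmem 3) (hends' 3) rfl rfl) (labc_loop ends o a₁ a₂ a₃ b (act6 σ fl ps) hred' (hmem 4) (hends' 4) rfl rfl) (labc_loop ends o a₁ a₂ a₃ b (act6 σ fl ps) hred' (hmem 5) (hends' 5) rfl rfl)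
    (labc_par ends o a₁ a₂ a₃ b (act6 σ fl ps) hred' (hmem 0) (hmem 1) (hne 0 1 (by decide)) (hends' 0) (hends' 1) rfl rfl rfl rfl) (labc_par ends o a₁ a₂ a₃ b (act6 σ fl ps) hred' (hmem 1) (hmem 2) (hne 1 2 (by decide)) (hends' 1) (hends' 2) rfl rfl rfl rfl) (labc_par ends o a₁ a₂ a₃ b (act6 σ fl ps) hred' (hmem 2) (hmem 3) (hne 2 3 (by decide)) (hends' 2) (hends' 3) rfl rfl rfl rfl) (labc_par ends o a₁ a₂ a₃ b (act6 σ fl ps) hred' (hmem 3) (hmem 4) (hne 3 4 (by decide)) (hends' 3) (hends' 4) rfl rfl rfl rfl) (labc_par ends o a₁ a₂ a₃ b (act6 σ fl ps) hred' (hmem 4) (hmem 5) (hne 4 5 (by decide)) (hends' 4) (hends' 5) rfl rfl rfl rfl)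
    (labc_root ends o a₁ a₂ a₃ b (act6 σ fl ps) hm hred' (hmem 0) (hends' 0) rfl rfl) (labc_root ends o a₁ a₂ a₃ b (act6 σ fl ps) hm hred' (hmem 1) (hends' 1) rfl rfl) (labc_root ends o a₁ a₂ a₃ b (act6 σ fl ps) hm hred' (hmem 2) (hends' 2) rfl rfl) (labc_root ends o a₁ a₂ a₃ b (act6 σ fl ps) hm hred' (hmem 3) (hends' 3) rfl rfl) (labc_root ends o a₁ a₂ a₃ b (act6 σ fl ps) hm hred' (hmem 4) (hends' 4) rfl rfl) (labc_root ends o a₁ a₂ a₃ b (act6 σ fl ps) hm hred' (hmem 5) (hends' 5) rfl rfl)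
    (labc_deg ends o a₁ a₂ a₃ b (act6 σ fl ps) hm (e (σ 0)) (e (σ 1)) (e (σ 2)) (e (σ 3)) (e (σ 4)) (e (σ 5)) hred'
      (hne 0 1 (by decide)) (hne 0 2 (by decide)) (hne 0 3 (by decide)) (hne 0 4 (by decide)) (hne 0 5 (by decide)) (hne 1 2 (by decide)) (hne 1 3 (by decide)) (hne 1 4 (by decide)) (hne 1 5 (by decide)) (hne 2 3 (by decide)) (hne 2 4 (by decide)) (hne 2 5 (by decide)) (hne 3 4 (by decide)) (hne 3 5 (by decide)) (hne 4 5 (by decide)) (hends' 0) (hends' 1) (hends' 2) (hends' 3) (hends' 4) (hends' 5))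
  intro e' he'
  simp only [Finset.mem_insert, Finset.mem_singleton] at he'
  rcases he' with rfl | rfl | rfl | rfl | rfl | rfl <;> exact hτ _

/-- **ROW 2′TRI ON THE REDUCED CLASS WITH SIX TYPED EDGES**, modulo `allOk6 = true`: every reduced
instance (`z ≡ false`, marks distinct up to `b = a₃` / `o = b`) with exactly six typed edges has a
nonnegative typed base. -/
theorem typedCount_nonneg_of_reduced_card_six (hall : allOk6 = true) (hm : MarksDistinct o a₁ a₂ a₃ b)
    (F : Finset E) (hF : F.card = 6) (hred : Reduced ends o a₁ a₂ a₃ b F) (τ : E → ℕ)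
    (hτ : ∀ e ∈ F, τ e = 1 ∨ τ e = 2) :
    0 ≤ typedCount F (fun _ => false) τ (K3 ends o a₁ a₂ a₃ b : Config E → Config E → Config E → R) := by
  let eq : F ≃ Fin 6 := (Finset.equivFin F).trans (finCongr hF)
  let e : Fin 6 → E := fun i => (eq.symm i).1
  have hinj : Function.Injective e := fun i j h => eq.symm.injective (Subtype.ext h)
  have hFe : Finset.univ.image e = F := by
    ext x
    simp only [Finset.mem_image, Finset.mem_univ, true_and]
    constructor
    · rintro ⟨i, rfl⟩
      exact (eq.symm i).2
    · intro hx
      exact ⟨eq ⟨x, hx⟩, by simp [e]⟩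
  rw [← hFe] at hred ⊢
  exact typedCount_sext_K3_nonneg ends o a₁ a₂ a₃ b hall hm e hinj hred τ
    (fun i => hτ (e i) (by rw [← hFe]; exact Finset.mem_image_of_mem e (Finset.mem_univ i)))

end Bridge6

end TwoTyped

end CovForm

end Summit.Ventures.PercRepro2
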